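import Literature.Probability.RandomPlanarGeometry.SAWPulledBridgeFreeEnergyZdLowerEnvelope
import HarnessLib

/-!
# The pulled-bridge free energy on `ℤ^{d+1}` is below its THIRD-order expansion:
# `e^{λ_B(y)} ≤ y + 2d − 2d/y + 2d(2d+1)/y²` for every `y ≥ 1`; hence `|e^{λ_B(y)} − (y + 2d − 2d/y)| ≤ 8d³/y²`

Topic `Literature/Probability/RandomPlanarGeometry` (continues `SAWPulledBridgeFreeEnergyZdEnvelope.lean` (the memory-one tilted count:
`sum_nbrs_zpow_eq`, `sum_unitSteps_zpow_eq`, one-step extensions `sum_saws_succ_eq_sum_freeNbrs` of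
`SAWPulledLargeForceExpansionZdLinearRadius.lean`, `exp_pulledBridgeFreeEnergy_le_add : e^{λ_B} ≤ y + 2d`) and
`SAWPulledBridgeFreeEnergyZdLowerEnvelope.lean` (`second_order_sub_le_exp_pulledBridgeFreeEnergy : y + 2d − 2d/y − 8d³/y² ≤ e^{λ_B}`);
`pulledBridgeZ_eq_sum_bridges`, `pulledBridgeFreeEnergy_le_log_of_geometric` as there).

The large-force coefficients of `e^{λ_B(y)} = Σ_k c_k^{(d)} y^{1−k}` on `ℤ^{d+1}` begin `1, 2d, −2d, 2d(2d+1), −4d²(2d+3), …`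
(`SAWPulledLargeForceExpansionZd{First,Third,Fourth}Order`).  The memory-one (non-reversing) tilted walk reproduces the first FOUR of
them: its transfer operator on the last-step types `{+e₀, lateral, −e₀}` with weights `y^{Δ(force coordinate)}`,

  `M = [[y, 2d, 0], [y, 2d−1, y⁻¹], [0, 2d, y⁻¹]]`  (rows: after `+e₀` / lateral / `−e₀`),

has a positive SUPERSOLUTION at the value `ρ := y + 2d − 2d/y + 2d(2d+1)/y²` for every `y ≥ 1`: with the potential
`Φ(+e₀) = 1`, `Φ(lateral) = ℓ := 1 − 1/y + (2d+1)/y²`, `Φ(−e₀) = 2d/y` one has `MΦ ≤ ρΦ` componentwise — with EQUALITY in the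
first row, slack `(2d+1)(y² + 2d(y−1)² + 4d²)/y⁴ · …` in the second and `2d(2d+1)((y−1)² + 2d−1)/y³` in the third
(`sum_freeNbrs_zpow_potential_le`).  Self-avoidance only removes terms, so the potential-weighted tilted sum over `n`-step
self-avoiding walks is at most `2ρⁿ` (`sum_saws_zpow_potential_le`; the very first step weighs `ρ + 2d/y² ≤ 2ρ`), and since bridges are self-avoiding walks:

* ★★★ **`exp_pulledBridgeFreeEnergy_le_third_order (d) (hy : 1 ≤ y) : e^{λ_B(y)} ≤ y + 2d − 2d/y + 2d(2d+1)/y²`** on `ℤ^{d+1}`,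
  every `y ≥ 1`, every `d` — the expansion truncated after the `y^{-2}` term is a GLOBAL upper bound;
* with the lower envelope of the previous file: ★★★ **`abs_exp_pulledBridgeFreeEnergy_sub_second_order_le :
  |e^{λ_B(y)} − (y + 2d − 2d/y)| ≤ 8d³/y²`** for every `y ≥ 1` and every `d ≥ 1` — the large-force expansion to second order with an
  EXPLICIT remainder, uniform in the dimension (the tree's `exp_pulledBridgeFreeEnergy_second_order_zd` has `∃ C y₁`);
  `pulledBridgeFreeEnergy_le_log_third_order` (the `log` form).

Printed status: Janse van Rensburg–Whittington (2013), §3.2 eq. (3.12)/(3.13) and Theorem 8 (`λ(y) ≤ log μ_d + log y`; first-order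
asymptotics); the explicit third-order envelope is, to our knowledge, not in print.  Provenance: lane «pcv-sawmu», a-p3 g26 (2026-08-28).
PURE STD, no data, no `decide`.
-/

noncomputable section

open Finset Filter Topology
open scoped BigOperators
open Literature.Probability.LatticeModels
open Literature.Probability.RandomPlanarGeometry.SAW

namespace Literature.Probability.RandomPlanarGeometry.SAW.Zd

/-! ### The potential and the one-step tilted sums -/

/-- The potential-weighted one-step sum: `Σ_{v ∈ unitSteps(ℤ^{d+1})} y^{v·e₀}·Φ(v·e₀) = y + 2d·ℓ + 2d/y²`
(`Φ(1) = 1`, `Φ(0) = ℓ`, `Φ(−1) = 2d/y`). [cite: JansevanRensburgWhittington2013, §3.2 eq. (3.12)–(3.13) (arXiv v4 p. 9)] -/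
theorem sum_unitSteps_zpow_potential_eq (d : ℕ) {y : ℝ} (hy : y ≠ 0) (ℓ : ℝ) :
    ∑ v ∈ unitSteps (d + 1), y ^ (v 0) * (if v 0 = 1 then (1 : ℝ) else if v 0 = 0 then ℓ else 2 * d / y)
      = y + 2 * d * ℓ + 2 * d / y ^ 2 := by
  classical
  rw [unitSteps, Finset.sum_image]
  · rw [Fintype.sum_prod_type, Fin.sum_univ_succ]
    have hzero : (∑ b : Bool, y ^ ((if b then (Pi.single (0 : Fin (d + 1)) (1 : ℤ) : Site (d + 1))
        else -(Pi.single (0 : Fin (d + 1)) (1 : ℤ) : Site (d + 1))) 0) *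
        (if (if b then (Pi.single (0 : Fin (d + 1)) (1 : ℤ) : Site (d + 1))
            else -(Pi.single (0 : Fin (d + 1)) (1 : ℤ) : Site (d + 1))) 0 = 1 then (1 : ℝ)
         else if (if b then (Pi.single (0 : Fin (d + 1)) (1 : ℤ) : Site (d + 1))
            else -(Pi.single (0 : Fin (d + 1)) (1 : ℤ) : Site (d + 1))) 0 = 0 then ℓ else 2 * d / y))
        = y + 2 * d / y ^ 2 := by
      simp
      field_simp
    have hsucc : ∀ j : Fin d, (∑ b : Bool, y ^ ((if b then (Pi.single (Fin.succ j) (1 : ℤ) : Site (d + 1))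
        else -(Pi.single (Fin.succ j) (1 : ℤ) : Site (d + 1))) 0) *
        (if (if b then (Pi.single (Fin.succ j) (1 : ℤ) : Site (d + 1))
            else -(Pi.single (Fin.succ j) (1 : ℤ) : Site (d + 1))) 0 = 1 then (1 : ℝ)
         else if (if b then (Pi.single (Fin.succ j) (1 : ℤ) : Site (d + 1))
            else -(Pi.single (Fin.succ j) (1 : ℤ) : Site (d + 1))) 0 = 0 then ℓ else 2 * d / y)) = ℓ + ℓ := by
      intro j; simp
    rw [hzero, Finset.sum_congr rfl fun j _ => hsucc j, Finset.sum_const, Finset.card_univ, Fintype.card_fin,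
      nsmul_eq_mul]
    ring
  · rintro ⟨k, b⟩ - ⟨k', b'⟩ - h
    have hk : k = k' := by
      by_contra hne
      have := congrFun h k
      cases b <;> cases b' <;> simp [Pi.single_eq_of_ne hne] at this
    subst hk
    cases b <;> cases b' <;> first | rfl | (exfalso; have := congrFun h k; simp at this)

/-- The potential-weighted sum over ALL lattice neighbours of `x`:
`Σ_{y' ~ x} y^{y'·e₀}·Φ(y'·e₀ − x·e₀) = y^{x·e₀}·(y + 2d·ℓ + 2d/y²)`. [cite: JansevanRensburgWhittington2013, §3.2 eq. (3.12)–(3.13) (arXiv v4 p. 9)] -/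
theorem sum_nbrs_zpow_potential_eq {d : ℕ} (x : Site (d + 1)) {y : ℝ} (hy : y ≠ 0) (ℓ : ℝ) :
    ∑ y' ∈ nbrs x, y ^ (y' 0) * (if y' 0 - x 0 = 1 then (1 : ℝ) else if y' 0 - x 0 = 0 then ℓ else 2 * d / y)
      = y ^ (x 0) * (y + 2 * d * ℓ + 2 * d / y ^ 2) := by
  classical
  rw [nbrs, Finset.sum_image (add_right_injective x).injOn, ← sum_unitSteps_zpow_potential_eq d hy ℓ, Finset.mul_sum]
  refine Finset.sum_congr rfl fun v _ => ?_
  rw [Pi.add_apply, zpow_add₀ hy, add_sub_cancel_left, mul_assoc]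

/-- ★★ **The supersolution step**: for an `(n+1)`-step self-avoiding walk `ω` on `ℤ^{d+1}`, `y ≥ 1`, `ℓ = 1 − 1/y + (2d+1)/y²` and
`ρ = y + 2d − 2d/y + 2d(2d+1)/y²`, the potential-weighted tilted weight of the free one-step extensions of `ω` is at most `ρ` times
the potential-weighted tilted weight of `ω`:
`Σ_{y' free} y^{y'·e₀} Φ(y'·e₀ − ω(n+1)·e₀) ≤ ρ · y^{ω(n+1)·e₀} · Φ(ω(n+1)·e₀ − ω(n)·e₀)`
(the reversed last step is occupied; `MΦ ≤ ρΦ` row by row). [cite: JansevanRensburgWhittington2013, §3.2 eq. (3.12)–(3.13) (arXiv v4 p. 9)] [cite: MadrasSlade1993, §1.1, eq. (1.1.1)] -/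
theorem sum_freeNbrs_zpow_potential_le {d n : ℕ} {ω : ℕ → Site (d + 1)} (hω : ω ∈ saws (d + 1) (n + 1)) {y : ℝ} (hy : 1 ≤ y) :
    ∑ y' ∈ freeNbrs ω (n + 1), y ^ (y' 0) *
        (if y' 0 - ω (n + 1) 0 = 1 then (1 : ℝ) else if y' 0 - ω (n + 1) 0 = 0 then 1 - 1 / y + (2 * d + 1) / y ^ 2 else 2 * d / y)
      ≤ (y + 2 * d - 2 * d / y + 2 * d * (2 * d + 1) / y ^ 2) * (y ^ (ω (n + 1) 0) *
        (if ω (n + 1) 0 - ω n 0 = 1 then (1 : ℝ) else if ω (n + 1) 0 - ω n 0 = 0 then 1 - 1 / y + (2 * d + 1) / y ^ 2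
          else 2 * d / y)) := by
  classical
  have hy0 : 0 < y := zero_lt_one.trans_le hy
  set ℓ : ℝ := 1 - 1 / y + (2 * d + 1) / y ^ 2 with hℓ
  set ρ : ℝ := y + 2 * d - 2 * d / y + 2 * d * (2 * d + 1) / y ^ 2 with hρ
  have hℓ0 : 0 < ℓ := by
    have : 1 / y ≤ 1 := (div_le_one hy0).2 hy
    have : 0 < (2 * (d : ℝ) + 1) / y ^ 2 := by positivity
    linarith
  have hΦ0 : ∀ δ : ℤ, 0 ≤ (if δ = 1 then (1 : ℝ) else if δ = 0 then ℓ else 2 * d / y) := by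
    intro δ; split_ifs <;> positivity
  obtain ⟨-, -, hadj, -⟩ := mem_saws.1 hω
  have had : (zdGraph (d + 1)).Adj (ω n) (ω (n + 1)) := hadj n (Nat.lt_succ_self n)
  have hprev : ω n ∈ nbrs (ω (n + 1)) := mem_nbrs.2 had.symm
  have hnot : ω n ∉ freeNbrs ω (n + 1) := fun h => (mem_freeNbrs.1 h).2 n (Nat.le_succ n) rfl
  have hsub : freeNbrs ω (n + 1) ⊆ (nbrs (ω (n + 1))).erase (ω n) := fun y' hy' =>
    Finset.mem_erase.2 ⟨fun h => hnot (h ▸ hy'), Finset.filter_subset _ _ hy'⟩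
  set x : Site (d + 1) := ω (n + 1) with hx
  have h1 : ∑ y' ∈ freeNbrs ω (n + 1), y ^ (y' 0) * (if y' 0 - x 0 = 1 then (1 : ℝ) else if y' 0 - x 0 = 0 then ℓ else 2 * d / y)
      ≤ ∑ y' ∈ (nbrs x).erase (ω n), y ^ (y' 0) * (if y' 0 - x 0 = 1 then (1 : ℝ) else if y' 0 - x 0 = 0 then ℓ else 2 * d / y) :=
    Finset.sum_le_sum_of_subset_of_nonneg hsub fun y' _ _ => mul_nonneg (zpow_pos hy0 _).le (hΦ0 _)
  rw [Finset.sum_erase_eq_sub hprev, sum_nbrs_zpow_potential_eq x hy0.ne' ℓ] at h1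
  -- the removed (occupied) term, by the type `δ` of the last step
  have hδ := abs_sub_le_one_of_adj had 0
  set h : ℤ := x 0 with hh
  have hP : 0 < y ^ h := zpow_pos hy0 _
  have hcase : h - ω n 0 = 1 ∨ h - ω n 0 = 0 ∨ h - ω n 0 = -1 := by
    rcases abs_le.1 hδ with ⟨h₁, h₂⟩; omega
  have hd0 : (0 : ℝ) ≤ d := Nat.cast_nonneg d
  have eΦ1 : (if (1 : ℤ) = 1 then (1 : ℝ) else if (1 : ℤ) = 0 then ℓ else 2 * d / y) = 1 := by simp
  have eΦ0 : (if (0 : ℤ) = 1 then (1 : ℝ) else if (0 : ℤ) = 0 then ℓ else 2 * d / y) = ℓ := by simp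
  have eΦm : (if (-1 : ℤ) = 1 then (1 : ℝ) else if (-1 : ℤ) = 0 then ℓ else 2 * d / y) = 2 * d / y := by simp
  refine h1.trans ?_
  rcases hcase with e | e | e
  · -- after `+e₀`: removed term `y^{h−1}·Φ(−1) = y^h·2d/y²`; equality `y + 2dℓ = ρ`
    have hp : ω n 0 = h - 1 := by omega
    rw [hp, show h - 1 - h = (-1 : ℤ) by ring, eΦm, show h - (h - 1) = (1 : ℤ) by ring, eΦ1, zpow_sub_one₀ hy0.ne']
    have key : y ^ h * (y + 2 * d * ℓ + 2 * d / y ^ 2) - y ^ h * y⁻¹ * (2 * d / y) = ρ * (y ^ h * 1) := by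
      rw [hρ, hℓ]; field_simp; ring
    rw [key]
  · -- after a lateral step: removed term `y^h·ℓ`; slack `(2d+1)(y² + 2d(y−1)² + 4d²)/y⁴`
    have hp : ω n 0 = h := by omega
    rw [hp, sub_self, eΦ0]
    have key : ρ * (y ^ h * ℓ) - (y ^ h * (y + 2 * d * ℓ + 2 * d / y ^ 2) - y ^ h * ℓ) =
        y ^ h * ((2 * d + 1) * (y ^ 2 + 2 * d * (y - 1) ^ 2 + 4 * d ^ 2) / y ^ 4) := by
      rw [hρ, hℓ]; field_simp; ring
    have : 0 ≤ y ^ h * ((2 * d + 1) * (y ^ 2 + 2 * d * (y - 1) ^ 2 + 4 * d ^ 2) / y ^ 4) := by positivity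
    linarith
  · -- after `−e₀`: removed term `y^{h+1}·Φ(1) = y^h·y`; slack `2d(2d+1)((y−1)² + 2d − 1)/y³` (`0` when `d = 0`)
    have hp : ω n 0 = h + 1 := by omega
    rw [hp, show h + 1 - h = (1 : ℤ) by ring, eΦ1, show h - (h + 1) = (-1 : ℤ) by ring, eΦm, zpow_add_one₀ hy0.ne', mul_one]
    have key : ρ * (y ^ h * (2 * d / y)) - (y ^ h * (y + 2 * d * ℓ + 2 * d / y ^ 2) - y ^ h * y) =
        y ^ h * (2 * d * (2 * d + 1) * ((y - 1) ^ 2 + (2 * d - 1)) / y ^ 3) := by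
      rw [hρ, hℓ]; field_simp; ring
    have hnn : 0 ≤ 2 * d * (2 * d + 1) * ((y - 1) ^ 2 + (2 * (d : ℝ) - 1)) := by
      rcases Nat.eq_zero_or_pos d with rfl | hd
      · simp
      · have h1d : (1 : ℝ) ≤ d := by exact_mod_cast hd
        have : (0 : ℝ) ≤ (y - 1) ^ 2 + (2 * d - 1) := by nlinarith
        positivity
    have : 0 ≤ y ^ h * (2 * d * (2 * d + 1) * ((y - 1) ^ 2 + (2 * d - 1)) / y ^ 3) := by positivity
    linarith

/-- ★★ **`Σ_{ω ∈ SAW_{n+1}(ℤ^{d+1})} y^{ω(n+1)·e₀}·Φ(last step) ≤ 2ρ^{n+1}`** for every `y ≥ 1`, with `ρ = y + 2d − 2d/y + 2d(2d+1)/y²`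
(induction over one-step extensions; the first step weighs `y + 2dℓ + 2d/y² = ρ + 2d/y² ≤ 2ρ`). [cite: JansevanRensburgWhittington2013, §3.2 eq. (3.12)–(3.13) (arXiv v4 p. 9)] -/
theorem sum_saws_zpow_potential_le (d : ℕ) {y : ℝ} (hy : 1 ≤ y) : ∀ n : ℕ,
    ∑ ω ∈ saws (d + 1) (n + 1), y ^ (ω (n + 1) 0) *
        (if ω (n + 1) 0 - ω n 0 = 1 then (1 : ℝ) else if ω (n + 1) 0 - ω n 0 = 0 then 1 - 1 / y + (2 * d + 1) / y ^ 2
          else 2 * d / y)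
      ≤ 2 * (y + 2 * d - 2 * d / y + 2 * d * (2 * d + 1) / y ^ 2) ^ (n + 1)
  | 0 => by
    classical
    have hy0 : 0 < y := zero_lt_one.trans_le hy
    have hℓ0 : 0 ≤ 1 - 1 / y + (2 * (d : ℝ) + 1) / y ^ 2 := by
      have : 1 / y ≤ 1 := (div_le_one hy0).2 hy
      have : 0 < (2 * (d : ℝ) + 1) / y ^ 2 := by positivity
      linarith
    -- the first step: all `2d + 2` neighbours of the origin are free, total weight `y + 2dℓ + 2d/y² = ρ + 2d/y² ≤ 2ρ`
    have hρ2 : y + 2 * d * (1 - 1 / y + (2 * (d : ℝ) + 1) / y ^ 2) + 2 * d / y ^ 2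
        ≤ 2 * (y + 2 * d - 2 * d / y + 2 * d * (2 * d + 1) / y ^ 2) := by
      have h1 : 0 ≤ 2 * (d : ℝ) * (1 - 1 / y) := mul_nonneg (by positivity) (by rw [sub_nonneg, div_le_one hy0]; exact hy)
      have h2 : 2 * (d : ℝ) / y ^ 2 ≤ 2 * d * (2 * d + 1) / y ^ 2 := div_le_div_of_nonneg_right (by nlinarith) (by positivity)
      have h3 : y + 2 * d * (1 - 1 / y + (2 * (d : ℝ) + 1) / y ^ 2) = y + 2 * d - 2 * d / y + 2 * d * (2 * d + 1) / y ^ 2 := by ring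
      have h4 : 2 * (d : ℝ) * (1 - 1 / y) = 2 * d - 2 * d / y := by ring
      nlinarith
    rw [pow_one, sum_saws_succ_eq_sum_freeNbrs]
    simp only [extendTo_of_lt (Nat.lt_succ_self 0), extendTo_of_le (le_refl 0)]
    have hω0 : ∀ ω ∈ saws (d + 1) 0, ∑ y' ∈ freeNbrs ω 0, y ^ (y' 0) *
        (if y' 0 - ω 0 0 = 1 then (1 : ℝ) else if y' 0 - ω 0 0 = 0 then 1 - 1 / y + (2 * d + 1) / y ^ 2 else 2 * d / y)
        ≤ 2 * (y + 2 * d - 2 * d / y + 2 * d * (2 * d + 1) / y ^ 2) := by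
      intro ω hω
      have h0 : ω 0 = 0 := (mem_saws.1 hω).1
      calc ∑ y' ∈ freeNbrs ω 0, y ^ (y' 0) *
            (if y' 0 - ω 0 0 = 1 then (1 : ℝ) else if y' 0 - ω 0 0 = 0 then 1 - 1 / y + (2 * d + 1) / y ^ 2 else 2 * d / y)
          ≤ ∑ y' ∈ nbrs (ω 0), y ^ (y' 0) *
            (if y' 0 - ω 0 0 = 1 then (1 : ℝ) else if y' 0 - ω 0 0 = 0 then 1 - 1 / y + (2 * d + 1) / y ^ 2 else 2 * d / y) :=
            Finset.sum_le_sum_of_subset_of_nonneg (Finset.filter_subset _ _) fun y' _ _ =>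
              mul_nonneg (zpow_pos hy0 _).le (by split_ifs <;> positivity)
        _ = y + 2 * d * (1 - 1 / y + (2 * (d : ℝ) + 1) / y ^ 2) + 2 * d / y ^ 2 := by
            rw [sum_nbrs_zpow_potential_eq _ hy0.ne', h0, Pi.zero_apply, zpow_zero, one_mul]
        _ ≤ 2 * (y + 2 * d - 2 * d / y + 2 * d * (2 * d + 1) / y ^ 2) := hρ2
    calc ∑ ω ∈ saws (d + 1) 0, ∑ y' ∈ freeNbrs ω 0, y ^ (y' 0) *
          (if y' 0 - ω 0 0 = 1 then (1 : ℝ) else if y' 0 - ω 0 0 = 0 then 1 - 1 / y + (2 * d + 1) / y ^ 2 else 2 * d / y)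
        ≤ ∑ _ω ∈ saws (d + 1) 0, 2 * (y + 2 * d - 2 * d / y + 2 * d * (2 * d + 1) / y ^ 2) := Finset.sum_le_sum hω0
      _ = 2 * (y + 2 * d - 2 * d / y + 2 * d * (2 * d + 1) / y ^ 2) := by rw [Finset.sum_const, card_saws, count_zero]; simp
  | n + 1 => by
    classical
    have hy0 : 0 < y := zero_lt_one.trans_le hy
    have hρ0 : 0 ≤ y + 2 * d - 2 * d / y + 2 * (d : ℝ) * (2 * d + 1) / y ^ 2 := by
      have : 2 * (d : ℝ) / y ≤ 2 * d := div_le_self (by positivity) hy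
      have : 0 ≤ 2 * (d : ℝ) * (2 * d + 1) / y ^ 2 := by positivity
      linarith
    rw [sum_saws_succ_eq_sum_freeNbrs]
    simp only [extendTo_of_lt (Nat.lt_succ_self (n + 1)), extendTo_of_le (le_refl (n + 1))]
    calc ∑ ω ∈ saws (d + 1) (n + 1), ∑ y' ∈ freeNbrs ω (n + 1), y ^ (y' 0) *
            (if y' 0 - ω (n + 1) 0 = 1 then (1 : ℝ) else if y' 0 - ω (n + 1) 0 = 0 then 1 - 1 / y + (2 * d + 1) / y ^ 2
              else 2 * d / y)
        ≤ ∑ ω ∈ saws (d + 1) (n + 1), (y + 2 * d - 2 * d / y + 2 * d * (2 * d + 1) / y ^ 2) * (y ^ (ω (n + 1) 0) *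
            (if ω (n + 1) 0 - ω n 0 = 1 then (1 : ℝ) else if ω (n + 1) 0 - ω n 0 = 0 then 1 - 1 / y + (2 * d + 1) / y ^ 2
              else 2 * d / y)) := Finset.sum_le_sum fun ω hω => sum_freeNbrs_zpow_potential_le hω hy
      _ = (y + 2 * d - 2 * d / y + 2 * d * (2 * d + 1) / y ^ 2) * ∑ ω ∈ saws (d + 1) (n + 1), y ^ (ω (n + 1) 0) *
            (if ω (n + 1) 0 - ω n 0 = 1 then (1 : ℝ) else if ω (n + 1) 0 - ω n 0 = 0 then 1 - 1 / y + (2 * d + 1) / y ^ 2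
              else 2 * d / y) := by rw [Finset.mul_sum]
      _ ≤ (y + 2 * d - 2 * d / y + 2 * d * (2 * d + 1) / y ^ 2) *
            (2 * (y + 2 * d - 2 * d / y + 2 * d * (2 * d + 1) / y ^ 2) ^ (n + 1)) :=
          mul_le_mul_of_nonneg_left (sum_saws_zpow_potential_le d hy n) hρ0
      _ = 2 * (y + 2 * d - 2 * d / y + 2 * d * (2 * d + 1) / y ^ 2) ^ (n + 1 + 1) := by
          rw [pow_succ' _ (n + 1)]; ring

/-! ### The third-order upper envelope -/

/-- **`Z^B_n(y) ≤ 2m⁻¹·ρⁿ`** for `d ≥ 1`, `y ≥ 1`, with `m := min 1 (min ℓ (2d/y)) > 0` the smallest potential and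
`ρ = y + 2d − 2d/y + 2d(2d+1)/y²` (bridges are self-avoiding walks; `y^{span} = y^{ω(n)·e₀} ≤ m⁻¹·y^{ω(n)·e₀}Φ`).
[cite: Beaton2015, §3 (bridges, Z^B_n)] [cite: JansevanRensburgWhittington2013, §3.2 eq. (3.12)–(3.13) (arXiv v4 p. 9)] -/
theorem pulledBridgeZ_le_third_order_pow (d n : ℕ) (hd : 1 ≤ d) {y : ℝ} (hy : 1 ≤ y) :
    pulledBridgeZ (d + 1) n y ≤
      2 * (min 1 (min (1 - 1 / y + (2 * d + 1) / y ^ 2) (2 * d / y)))⁻¹ *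
        (y + 2 * d - 2 * d / y + 2 * d * (2 * d + 1) / y ^ 2) ^ n := by
  classical
  have hy0 : 0 < y := zero_lt_one.trans_le hy
  set ℓ : ℝ := 1 - 1 / y + (2 * d + 1) / y ^ 2 with hℓ
  set ρ : ℝ := y + 2 * d - 2 * d / y + 2 * d * (2 * d + 1) / y ^ 2 with hρ
  set m : ℝ := min 1 (min ℓ (2 * d / y)) with hm
  have hℓ0 : 0 < ℓ := by
    have : 1 / y ≤ 1 := (div_le_one hy0).2 hy
    have : 0 < (2 * (d : ℝ) + 1) / y ^ 2 := by positivity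
    linarith
  have hd0 : (0 : ℝ) < d := by exact_mod_cast hd
  have hm0 : 0 < m := lt_min one_pos (lt_min hℓ0 (by positivity))
  have hm1 : m ≤ 1 := min_le_left _ _
  have hΦm : ∀ δ : ℤ, m ≤ (if δ = 1 then (1 : ℝ) else if δ = 0 then ℓ else 2 * d / y) := by
    intro δ; split_ifs
    · exact min_le_left _ _
    · exact (min_le_right _ _).trans (min_le_left _ _)
    · exact (min_le_right _ _).trans (min_le_right _ _)
  rcases n with _ | n
  · rw [pulledBridgeZ_zero, pow_zero, mul_one]
    have := (one_le_inv₀ hm0).2 hm1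
    linarith
  rw [pulledBridgeZ_eq_sum_bridges]
  have hsub : bridges (d + 1) (n + 1) ⊆ saws (d + 1) (n + 1) := fun ω hω => (mem_bridges.1 hω).1
  have hT := sum_saws_zpow_potential_le d hy n
  -- `y^{span} ≤ m⁻¹ · y^{h} Φ(δ)` termwise
  have hterm : ∀ ω ∈ bridges (d + 1) (n + 1), y ^ (ω (n + 1) 0).toNat ≤ m⁻¹ * (y ^ (ω (n + 1) 0) *
      (if ω (n + 1) 0 - ω n 0 = 1 then (1 : ℝ) else if ω (n + 1) 0 - ω n 0 = 0 then ℓ else 2 * d / y)) := by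
    intro ω hω
    have hnn : 0 ≤ ω (n + 1) 0 := by
      obtain ⟨hs, hbr⟩ := mem_bridges.1 hω
      have := (hbr (n + 1) (Nat.succ_pos n) le_rfl).1
      rw [(mem_saws.1 hs).1, Pi.zero_apply] at this
      exact this.le
    rw [← zpow_natCast, Int.toNat_of_nonneg hnn, ← mul_assoc]
    have hP : 0 < y ^ (ω (n + 1) 0) := zpow_pos hy0 _
    calc y ^ (ω (n + 1) 0) = m⁻¹ * y ^ (ω (n + 1) 0) * m := by field_simp
      _ ≤ m⁻¹ * y ^ (ω (n + 1) 0) * (if ω (n + 1) 0 - ω n 0 = 1 then (1 : ℝ) else if ω (n + 1) 0 - ω n 0 = 0 then ℓ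
            else 2 * d / y) := mul_le_mul_of_nonneg_left (hΦm _) (by positivity)
  calc ∑ ω ∈ bridges (d + 1) (n + 1), y ^ (ω (n + 1) 0).toNat
      ≤ ∑ ω ∈ bridges (d + 1) (n + 1), m⁻¹ * (y ^ (ω (n + 1) 0) *
          (if ω (n + 1) 0 - ω n 0 = 1 then (1 : ℝ) else if ω (n + 1) 0 - ω n 0 = 0 then ℓ else 2 * d / y)) :=
        Finset.sum_le_sum hterm
    _ ≤ ∑ ω ∈ saws (d + 1) (n + 1), m⁻¹ * (y ^ (ω (n + 1) 0) *
          (if ω (n + 1) 0 - ω n 0 = 1 then (1 : ℝ) else if ω (n + 1) 0 - ω n 0 = 0 then ℓ else 2 * d / y)) :=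
        Finset.sum_le_sum_of_subset_of_nonneg hsub fun ω _ _ =>
          mul_nonneg (inv_pos.2 hm0).le (mul_nonneg (zpow_pos hy0 _).le ((hm0.le).trans (hΦm _)))
    _ = m⁻¹ * ∑ ω ∈ saws (d + 1) (n + 1), y ^ (ω (n + 1) 0) *
          (if ω (n + 1) 0 - ω n 0 = 1 then (1 : ℝ) else if ω (n + 1) 0 - ω n 0 = 0 then ℓ else 2 * d / y) := by
        rw [Finset.mul_sum]
    _ ≤ m⁻¹ * (2 * ρ ^ (n + 1)) := mul_le_mul_of_nonneg_left hT (inv_pos.2 hm0).le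
    _ = 2 * m⁻¹ * ρ ^ (n + 1) := by ring

/-- ★★★ **THE THIRD-ORDER UPPER ENVELOPE**: `e^{λ_B(y)} ≤ y + 2d − 2d/y + 2d(2d+1)/y²` on `ℤ^{d+1}` for every `y ≥ 1` and every `d` —
the large-force expansion `y + c_1^{(d)} + c_2^{(d)}/y + c_3^{(d)}/y²` truncated after its third coefficient bounds `e^{λ_B}` from above at ALL
forces `y ≥ 1` (memory-one transfer potential; `d = 0`: `e^{λ_B(y)} = y`). [cite: JansevanRensburgWhittington2013, §3.2 eq. (3.12)–(3.13) and Theorem 8 (arXiv v4 pp. 9, 11)] -/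
theorem exp_pulledBridgeFreeEnergy_le_third_order (d : ℕ) {y : ℝ} (hy : 1 ≤ y) :
    Real.exp (pulledBridgeFreeEnergy (d + 1) y) ≤ y + 2 * d - 2 * d / y + 2 * d * (2 * d + 1) / y ^ 2 := by
  have hy0 : 0 < y := zero_lt_one.trans_le hy
  rcases Nat.eq_zero_or_pos d with rfl | hd
  · have h := exp_pulledBridgeFreeEnergy_le_add 0 hy
    simpa using h
  have hd0 : (0 : ℝ) < d := by exact_mod_cast hd
  have hℓ0 : 0 < 1 - 1 / y + (2 * (d : ℝ) + 1) / y ^ 2 := by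
    have : 1 / y ≤ 1 := (div_le_one hy0).2 hy
    have : 0 < (2 * (d : ℝ) + 1) / y ^ 2 := by positivity
    linarith
  have hm0 : 0 < min 1 (min (1 - 1 / y + (2 * (d : ℝ) + 1) / y ^ 2) (2 * d / y)) := lt_min one_pos (lt_min hℓ0 (by positivity))
  have hρ0 : 0 < y + 2 * d - 2 * d / y + 2 * (d : ℝ) * (2 * d + 1) / y ^ 2 := by
    have : 2 * (d : ℝ) / y ≤ 2 * d := div_le_self (by positivity) hy
    have : 0 < 2 * (d : ℝ) * (2 * d + 1) / y ^ 2 := by positivity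
    linarith
  have h := pulledBridgeFreeEnergy_le_log_of_geometric d hy0 (by positivity : (0 : ℝ) < 2 * (min 1 (min (1 - 1 / y
      + (2 * (d : ℝ) + 1) / y ^ 2) (2 * d / y)))⁻¹) hρ0 fun N => pulledBridgeZ_le_third_order_pow d N hd hy
  have h2 := Real.exp_le_exp.2 h
  rwa [Real.exp_log hρ0] at h2

/-- The `log` form: `λ_B(y) ≤ log(y + 2d − 2d/y + 2d(2d+1)/y²)` for `y ≥ 1`. [cite: JansevanRensburgWhittington2013, §3.2 eq. (3.12) (arXiv v4 p. 9)] -/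
theorem pulledBridgeFreeEnergy_le_log_third_order (d : ℕ) {y : ℝ} (hy : 1 ≤ y) :
    pulledBridgeFreeEnergy (d + 1) y ≤ Real.log (y + 2 * d - 2 * d / y + 2 * d * (2 * d + 1) / y ^ 2) := by
  have h := exp_pulledBridgeFreeEnergy_le_third_order d hy
  have hpos : 0 < Real.exp (pulledBridgeFreeEnergy (d + 1) y) := Real.exp_pos _
  have := Real.log_le_log hpos h
  rwa [Real.log_exp] at this

/-- ★★★ **THE LARGE-FORCE EXPANSION TO SECOND ORDER WITH AN EXPLICIT, DIMENSION-UNIFORM REMAINDER**: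
`|e^{λ_B(y)} − (y + 2d − 2d/y)| ≤ 8d³/y²` on `ℤ^{d+1}` for every `y ≥ 1` and every `d ≥ 1`
(upper: `2d(2d+1) ≤ 8d³`; lower: `second_order_sub_le_exp_pulledBridgeFreeEnergy`). The tree's `exp_pulledBridgeFreeEnergy_second_order_zd`
is the `∃ C y₁` form of this. [cite: JansevanRensburgWhittington2013, §3.2 Theorem 8 (arXiv v4 p. 11)] -/
theorem abs_exp_pulledBridgeFreeEnergy_sub_second_order_le {d : ℕ} (hd : 1 ≤ d) {y : ℝ} (hy : 1 ≤ y) :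
    |Real.exp (pulledBridgeFreeEnergy (d + 1) y) - (y + 2 * d - 2 * d / y)| ≤ 8 * d ^ 3 / y ^ 2 := by
  have hy0 : 0 < y := zero_lt_one.trans_le hy
  have hd1 : (1 : ℝ) ≤ d := by exact_mod_cast hd
  have hup := exp_pulledBridgeFreeEnergy_le_third_order d hy
  have hlow := second_order_sub_le_exp_pulledBridgeFreeEnergy d hy
  have hdd : (d : ℝ) * 1 ≤ d * d := mul_le_mul_of_nonneg_left hd1 (by positivity)
  have hc0 : 2 * (d : ℝ) * (2 * d + 1) ≤ 8 * d ^ 3 := by nlinarith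
  have hc : 2 * (d : ℝ) * (2 * d + 1) / y ^ 2 ≤ 8 * d ^ 3 / y ^ 2 := div_le_div_of_nonneg_right hc0 (by positivity)
  rw [abs_le]
  exact ⟨by linarith, by linarith⟩

/-- The two one-sided second-order statements together: `−8d³/y² ≤ e^{λ_B(y)} − (y + 2d − 2d/y) ≤ 2d(2d+1)/y²` (`y ≥ 1`, every `d`).
[cite: JansevanRensburgWhittington2013, §3.2 Theorem 8 (arXiv v4 p. 11)] -/
theorem exp_pulledBridgeFreeEnergy_sub_second_order_mem_Icc (d : ℕ) {y : ℝ} (hy : 1 ≤ y) :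
    Real.exp (pulledBridgeFreeEnergy (d + 1) y) - (y + 2 * d - 2 * d / y) ∈
      Set.Icc (-(8 * (d : ℝ) ^ 3 / y ^ 2)) (2 * d * (2 * d + 1) / y ^ 2) := by
  have hup := exp_pulledBridgeFreeEnergy_le_third_order d hy
  have hlow := second_order_sub_le_exp_pulledBridgeFreeEnergy d hy
  exact ⟨by linarith, by linarith⟩

end Literature.Probability.RandomPlanarGeometry.SAW.Zd
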